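import Summits.QuantumFields.YangMills.Theorems.BalabanUVNodesN22WindowSoftTwoPointAtSlotsNonzeroChartModel

/-!
# NODE N22 (NE9) — A6, NEXT RUNG (part 2∕2): (A)'s TWO ACTIVITY-LEVEL CAPSTONES `windowedNE9_localizedSum_of_activitySlots` ∕ `windowedDecay_localizedSum_of_activitySlots`
# FIRE AT THE NON-ZERO PROBE CHART `x ↦ ix` ON THE NON-DEGENERATE U(1) MODEL of `…AtSlotsNonzeroChartModel`

Cell `pub-ymgap`, Track A (HUMAN RULING D-0062), WIDTH SEAT `dag-n22-w2` (g4) on node n22 = NE9; `--kind proof --supports stmt-QuantumFields-20544 --as helper`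
(K3⁷ `SpineGivenEndpointR13SepCoPH`), COUNT-NEUTRAL; THEOREMS ONLY (0 `def`, 0 `sorry`, standard axioms).  Sequel of `…AtSlotsNonzeroChartModel` (this seat, g4; the model, W1's
slots on it, the complexification and its clauses); trigger and rationale there (referee ref-F g20 READ-497 NOTE-1 on p602050: «a NON-zero chart witness would be A6's next rung»).

WHAT.  §4 ★★★ `windowedNE9_localizedSum_of_activitySlots_fires_nonzeroChart` ∕ ★★★ `windowedDecay_localizedSum_of_activitySlots_fires_nonzeroChart`: for EVERY family `F`, cube side
`M = L^{m′}`, window `W`, tails `δ₀ > 0`, `B₃ > 0`, ball radius `r > 0`, fading ratio `ω ≥ 0` and Road 1's numerals (`A > 0` with the doubled smallness, `R ≥ 2κ₀ + 128 log 162 + 2` —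
inhabited by (C)'s `smokeNumerals`), and ANY towers `S` whose activities ARE the U(1) model display, ALL hypotheses of (A)'s two capstones (p605956) hold at the NON-ZERO chart
`ρ = (x ↦ ix)`, the pulled-back reading `emb K k W = (b ↦ W_{b.dir}(blockIter (k+1) b.src), 0)`, the singleton basis, prefix sets `univ`, the model spaces, the tail-weighted
complexification on the balls `‖z‖ < r` — so the capstones APPLY and return W1-19b's letters `WindowedNE9 F (localizedSum F S emb) ρ bV W δ₁ (C_9·Λ)` (`Λ (k+1) i = A ω^{k+1−i}`,
`δ₁ = ½min{δ₀, κ(4M)⁻¹}`, `κ = 2κ₀(64,8)`) and `WindowedDecay … μ ν δ₁`.  §5 `exists_u1Towers` (the model towers exist: one term per polymer, index type `𝐃_{k+1}`); `chart_ne_zero`;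
★★★ `exists_nondegenerate_model_capstones_fire_nonzeroChart` — PACKAGED: towers whose activities VANISH at the zero configuration, are NON-ZERO at the unit configuration and carry a
genuine phase in EVERY young coupling, on which BOTH letters hold at the non-zero chart with (C)'s numerals.  So at this model the letters' content is NOT free: the chart is non-zero,
the reading is non-constant, the activities read the configuration — the three things the zero-chart ∕ empty-tower ∕ configuration-constant witnesses (p602050, p607185, p611030) lack.

HONEST FRAMING (binding).  An A6 MODEL WITNESS, count-neutral: joint satisfiability of (A)'s whole activity-level antecedent AT A NON-ZERO CHART ON A NON-DEGENERATE MODEL, and the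
capstones' elaboration end to end there.  It is NOT NODE 00's tower, NOT the minimizer reading, NOT print's chart `θ.ρ8`; nothing of the record is claimed to meet anything; nothing
of Bałaban's asserted or constructed; N22∕(D4) NOT discharged (typed 28∕28 · discharged 5∕27 UNCHANGED); K3⁷ OPEN, NOT claimed; no count claim (the chair's single count line is
the only count); no summit statement is proved by this seat; one finite 𝕋⁴ programme at fixed ε — R4 closes the CONDITIONAL rung `BalabanLadder.UV` only; NOTHING about the
continuum limit, ℝ⁴, OS axioms, a mass gap or the Clay problem is proved or claimed by any of this.  References (TYPES only): [I] = Bałaban, CMP 109 (1987) (1.7) p. 261, p. 263,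
(1.20)–(1.21) p. 264, p. 282, (5.10) p. 293; [II] = CMP 116 (1988) (2.13)–(2.14) pp. 14–15, (2.38) p. 20.
-/

noncomputable section

open Filter Topology Metric Set
open scoped BigOperators

namespace YMDAG.N22.WindowSoftTwoPoint.NonzeroChart

open Literature.MathematicalPhysics.QuantumFieldTheory.Balaban1983to89
open Literature.MathematicalPhysics.QuantumFieldTheory.Balaban1983to89.T4Continuum (T4Family)
open Literature.MathematicalPhysics.QuantumFieldTheory.Balaban1983to89.Node00.Sect2 (domCount domSys CPair)
open Literature.MathematicalPhysics.QuantumFieldTheory.Balaban1983to89.Node00.LocalizedSum17 (localizedSum ReadingMaps)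
open Literature.MathematicalPhysics.QuantumFieldTheory.Balaban1983to89.Node00.W1 (ClusterTower ClusterStep)
open Literature.MathematicalPhysics.QuantumFieldTheory.Balaban1983to89.Node00.U3OfKernels (histPrefix)
open Literature.MathematicalPhysics.QuantumFieldTheory.Balaban1983to89.Node00.U3KernelLetters (WindowedNE9 WindowedDecay)
open Literature.MathematicalPhysics.QuantumFieldTheory.Balaban1983to89.B12Decay510 (delta1)
open Literature.MathematicalPhysics.QuantumFieldTheory.Balaban1983to89.B12Decay510Window (K₁)
open Literature.MathematicalPhysics.QuantumFieldTheory.Balaban1983to89.B12Decay510Torus (distCT nearT nearT_mem nearT_le distCT_nonneg)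
open Literature.MathematicalPhysics.QuantumFieldTheory.Balaban1983to89.B12TreeDecay (K₀ kappa₀ K₀_pos kappa₀_nonneg)
open Literature.MathematicalPhysics.QuantumFieldTheory.Balaban1983to89.TreeLengthTorus (TPt TDom)
open Literature.MathematicalPhysics.QuantumFieldTheory.Balaban1983to89.B14.Eq22Determines (blockIter)
open Literature.MathematicalPhysics.QuantumFieldTheory.Balaban1983to89.B15DeterminingSets (embIter)
open YMDAG.N22.W1.CouplingRadii.PhaseTower (norm_cexp_I_mul_ofReal)

/-! ## §4 ★★★ (A)'s TWO CAPSTONES FIRE at the model: non-zero chart `x ↦ ix`, reading = the coarse U(1) probe pulled back to the fine bonds, U(1) model towers -/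

section Fire

variable (F : T4Family) (M : ℕ) [NeZero M] (S : (K : ℕ) → ClusterTower (F.P K) ℂ M) {A R ω r δ₀ B₃ : ℝ}
variable (hS : ∀ (K k : ℕ) (g : Fin (k + 1) → ℝ) (φ : CPair (F.P K) ℂ) (Z : (domSys (F.P K) M (k + 1)).Dom),
  ((S K) k).H g φ Z = ((A * Real.exp (-(R * (domSys (F.P K) M (k + 1)).dj Z)) : ℝ) : ℂ) *
    Complex.exp (Complex.I * ((∑ i : Fin (k + 1), g i * ω ^ (k + 1 - (i : ℕ)) : ℝ) : ℂ)) *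
    (((Fintype.card (Fin (F.P K).d × Site (F.P K) (k + 1)) : ℂ))⁻¹ *
      ∑ lt : Fin (F.P K).d × Site (F.P K) (k + 1),
        ((Real.exp (-(r / (B₃ * Real.exp (-δ₀ * distCT (domCount (F.P K) M (k + 1)) M
            (fun i => (ZMod.cast ((blockIter (k + 1) (embIter (k + 1) lt.2)) i) : ZMod (domCount (F.P K) M (k + 1) * M)))
            (nearT (M := M) (fun i => (ZMod.cast ((blockIter (k + 1) (embIter (k + 1) lt.2)) i) : ZMod (domCount (F.P K) M (k + 1) * M))) Z))))) : ℝ) : ℂ) *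
        φ.1 ⟨embIter (k + 1) lt.2, lt.1⟩))
include hS

open Classical in
/-- ★★★ **THE HISTORY-LIPSCHITZ CAPSTONE FIRES AT A NON-ZERO CHART** (A6, next rung after (C) p607185 ∕ g2 p602050: referee ref-F READ-497 NOTE-1).  For EVERY family `F`,
cube side `M = L^{m′}`, window `W`, tails `δ₀ > 0`, `B₃ > 0`, ball radius `r > 0`, fading ratio `ω ≥ 0`, and Road 1's numerals (`A > 0` with the doubled smallness,
`R ≥ 2κ₀ + 128 log 162 + 2` — inhabited: (C) `smokeNumerals`), the hypotheses of (A) `windowedNE9_localizedSum_of_activitySlots` ALL hold for: the U(1) MODEL TOWERS `S`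
(activities `A e^{−R d(Z)}·e^{iΣ g_i ω^{k+1−i}}·avg_{(l,t)} e^{−r∕w_Z}φ.1⟨embIter t, l⟩` — NON-CONSTANT in the configuration, history-dependent), the READING `emb K k W = (b ↦
W_{b.dir}(blockIter (k+1) b.src), 0)` (the coarse probe field pulled back to the fine bonds — NON-CONSTANT), the NON-ZERO CHART `ρ = (x ↦ ix) : ℝ →L[ℝ] ℂ` (`exp ρB = e^{iB} ∈ U(1)`),
the basis `Basis.singleton`, the complexification `ι_X B = ((l,t) ↦ B_{l,t}·w_X(t))` (INJECTIVE) with site weights EQUAL to the p. 282 tails `w_X(t) = B₃e^{−δ₀ distCT(cast t, X)}`, the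
readings `Φ_X z = (b ↦ e^{i z_{b.dir,t_b}∕w_X(t_b)}, 0)` on `ball 0 r`, the spaces `sp Z = {φ | ‖φ.1 b‖ ≤ e^{r∕w_Z(t_b)}}`, prefix sets `univ`: so the capstone APPLIES and returns W1-19b's
letter `WindowedNE9 F (localizedSum F S emb) ρ bV W δ₁ (C_9·Λ)`, `Λ (k+1) i = A ω^{k+1−i}` — at a chart where the conclusion is NOT free.  MODEL witness (declared): NOT NODE 00's towers,
NOT the minimizer reading, NOT print's chart `θ.ρ8`; nothing of the record is claimed. -/
theorem windowedNE9_localizedSum_of_activitySlots_fires_nonzeroChart (m' : ℕ) (hM : M = F.L ^ m') (W : Set (ℕ → ℝ))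
    (hA : 0 < A) (hsmall : 2 * A * Real.exp (5 * (2 * kappa₀ (4 * 2 ^ 4) (2 * 4)) + 1) * K₀ 64 8 * 9 * 64 ≤ 1)
    (hR : 2 * kappa₀ (4 * 2 ^ 4) (2 * 4) + 2 * (64 * Real.log 162) + 2 ≤ R) (hω : 0 ≤ ω) (hr : 0 < r) (hδ₀ : 0 < δ₀) (hB₃ : 0 < B₃) :
    WindowedNE9 F (localizedSum F S (fun K k W => ((fun b : PBond (F.P K) 0 => W b.dir (blockIter (k + 1) b.src)), fun _ => (0 : ℂ))))
      ((ContinuousLinearMap.id ℝ ℝ).smulRight Complex.I) (Module.Basis.singleton Unit ℝ) W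
      (delta1 δ₀ (2 * kappa₀ (4 * 2 ^ 4) (2 * 4)) ((M : ℝ) * 4))
      (fun k i => (16 * (8 * (Real.exp 1 * 9 * 64 * K₀ 64 8 ^ 2)) * B₃ ^ 2 / r ^ 2) *
        Real.exp (delta1 δ₀ (2 * kappa₀ (4 * 2 ^ 4) (2 * 4)) ((M : ℝ) * 4) * ((M : ℝ) * 4) * 3) * K₀ (4 * 2 ^ 4) (2 * 4) * K₁ 4 (δ₀ / 2) *
          (A * ω ^ (k - i))) := by
  have hκ : 0 ≤ kappa₀ (4 * 2 ^ 4) (2 * 4) := kappa₀_nonneg (by positivity) _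
  -- the site weights of the model (= the p. 282 tail profile), their sign and monotonicity in the domain
  let wt : (K k : ℕ) → (domSys (F.P K) M (k + 1)).Dom → Site (F.P K) (k + 1) → ℝ := fun K k X t =>
    B₃ * Real.exp (-δ₀ * distCT (domCount (F.P K) M (k + 1)) M (fun i => (ZMod.cast (t i) : ZMod (domCount (F.P K) M (k + 1) * M)))
      (nearT (M := M) (fun i => (ZMod.cast (t i) : ZMod (domCount (F.P K) M (k + 1) * M))) X))
  have hw0 : ∀ (K k : ℕ) (X : (domSys (F.P K) M (k + 1)).Dom) (t : Site (F.P K) (k + 1)), 0 < wt K k X t :=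
    fun K k X t => tailWeight_pos _ X hB₃
  have hwmono : ∀ (K k : ℕ) (Z X : (domSys (F.P K) M (k + 1)).Dom), Z.1 ⊆ X.1 → ∀ t : Site (F.P K) (k + 1), wt K k Z t ≤ wt K k X t :=
    fun K k Z X h t => tailWeight_mono _ h hB₃.le hδ₀.le
  refine windowedNE9_localizedSum_of_activitySlots F m' M hM S _ _ _ W (fun _ _ => univ) (fun _ _ _ _ => mem_univ _)
    (fun K k Z => {φ : CPair (F.P K) ℂ | ∀ b : PBond (F.P K) 0, ‖φ.1 b‖ ≤ Real.exp (r / wt K k Z (blockIter (k + 1) b.src))})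
    (fun n i => A * ω ^ (n - i)) hA (by positivity) le_rfl (by linarith) hR hsmall (fun n i => by positivity) hδ₀ hB₃.le hr ?_ ?_
    (fun K k => Fin (F.P K).d → Site (F.P K) (k + 1) → ℂ)
    (fun K k X => LinearMap.toContinuousLinearMap
      { toFun := fun B : Fin (F.P K).d → Site (F.P K) (k + 1) → ℝ => fun l t => ((B l t : ℝ) : ℂ) * (wt K k X t : ℂ)
        map_add' := fun B B' => by funext l t; simp only [Pi.add_apply]; push_cast; ring
        map_smul' := fun c B => by funext l t; simp only [Pi.smul_apply, smul_eq_mul, RingHom.id_apply, Complex.real_smul]; push_cast; ring })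
    (fun K k X z => ((fun b : PBond (F.P K) 0 => Complex.exp (Complex.I * z b.dir (blockIter (k + 1) b.src) / (wt K k X (blockIter (k + 1) b.src) : ℂ))),
      fun _ => (0 : ℂ)))
    (fun K k X => ball 0 r) (fun _ _ _ => isOpen_ball) (fun _ _ _ => Subset.rfl) ?_ ?_ ?_ wt (fun K k X t => (hw0 K k X t).le) ?_ ?_
  · -- W1's (2.38) value slot at every model step
    intro K k
    exact bound238_u1Step ((S K) k) (wt K k) (hS K k) hA.le _
  · -- W1's differenced slot with the fading moduli `A ω^{k+1−i}`
    intro K k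
    exact youngLipschitz_u1Step ((S K) k) (wt K k) (hS K k) hA.le hω _
  · -- activity holomorphy along the complexified reading
    intro g _ K k X Z _
    exact differentiableOn_H_comp_Φ ((S K) k) (wt K k) (hS K k) (wt K k X) (histPrefix g k) Z _
  · -- the chart clause: Φ_X (ι_X B) = emb (e^{iB})
    intro K k X B
    rw [LinearMap.coe_toContinuousLinearMap']
    exact Φ_ι_eq (wt K k X) (fun t => hw0 K k X t) B
  · -- the space clause on the ball (weights monotone in the domain)
    intro K k X z hz Z hZX
    exact Φ_mem_sp (wt K k) (fun Z t => hw0 K k Z t) (fun Z X h t => hwmono K k Z X h t) X hz Z hZX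
  · -- unit probe fields have complexified norm ≤ the site weight
    intro K k X l t c
    rw [LinearMap.coe_toContinuousLinearMap']
    exact norm_ι_single_le (wt K k X) (fun t => (hw0 K k X t).le) l t c
  · -- the site weights ARE the tails
    intro K k X t
    exact le_rfl

open Classical in
/-- ★★★ **THE VALUE CAPSTONE FIRES AT THE SAME NON-ZERO-CHART MODEL**: ALL hypotheses of (A) `windowedDecay_localizedSum_of_activitySlots` hold for the U(1) model towers, the
pulled-back reading, the chart `x ↦ ix`, the tail-weighted complexification and the ball readings (numerals: `0 ≤ A` and the SINGLE smallness, implied by the doubled one), so it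
returns W1-19b's value letter `WindowedDecay F (localizedSum F S emb) ρ bV W μ ν δ₁` at every `(μ, ν)`.  MODEL witness (declared). -/
theorem windowedDecay_localizedSum_of_activitySlots_fires_nonzeroChart (m' : ℕ) (hM : M = F.L ^ m') (W : Set (ℕ → ℝ))
    (hA : 0 < A) (hsmall : 2 * A * Real.exp (5 * (2 * kappa₀ (4 * 2 ^ 4) (2 * 4)) + 1) * K₀ 64 8 * 9 * 64 ≤ 1)
    (hR : 2 * kappa₀ (4 * 2 ^ 4) (2 * 4) + 2 * (64 * Real.log 162) + 2 ≤ R) (hr : 0 < r) (hδ₀ : 0 < δ₀) (hB₃ : 0 < B₃) (μ ν : Fin 4) :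
    WindowedDecay F (localizedSum F S (fun K k W => ((fun b : PBond (F.P K) 0 => W b.dir (blockIter (k + 1) b.src)), fun _ => (0 : ℂ))))
      ((ContinuousLinearMap.id ℝ ℝ).smulRight Complex.I) (Module.Basis.singleton Unit ℝ) W μ ν
      (delta1 δ₀ (2 * kappa₀ (4 * 2 ^ 4) (2 * 4)) ((M : ℝ) * 4)) := by
  have hκ : 0 ≤ kappa₀ (4 * 2 ^ 4) (2 * 4) := kappa₀_nonneg (by positivity) _
  have hsmall1 : A * Real.exp (5 * (2 * kappa₀ (4 * 2 ^ 4) (2 * 4)) + 1) * K₀ 64 8 * 9 * 64 ≤ 1 := by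
    have h0 : 0 ≤ A * Real.exp (5 * (2 * kappa₀ (4 * 2 ^ 4) (2 * 4)) + 1) * K₀ 64 8 * 9 * 64 := by have := K₀_pos 64 8; positivity
    have h2 : 2 * A * Real.exp (5 * (2 * kappa₀ (4 * 2 ^ 4) (2 * 4)) + 1) * K₀ 64 8 * 9 * 64 =
        2 * (A * Real.exp (5 * (2 * kappa₀ (4 * 2 ^ 4) (2 * 4)) + 1) * K₀ 64 8 * 9 * 64) := by ring
    have h3 := hsmall; rw [h2] at h3; linarith
  let wt : (K k : ℕ) → (domSys (F.P K) M (k + 1)).Dom → Site (F.P K) (k + 1) → ℝ := fun K k X t =>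
    B₃ * Real.exp (-δ₀ * distCT (domCount (F.P K) M (k + 1)) M (fun i => (ZMod.cast (t i) : ZMod (domCount (F.P K) M (k + 1) * M)))
      (nearT (M := M) (fun i => (ZMod.cast (t i) : ZMod (domCount (F.P K) M (k + 1) * M))) X))
  have hw0 : ∀ (K k : ℕ) (X : (domSys (F.P K) M (k + 1)).Dom) (t : Site (F.P K) (k + 1)), 0 < wt K k X t :=
    fun K k X t => tailWeight_pos _ X hB₃
  have hwmono : ∀ (K k : ℕ) (Z X : (domSys (F.P K) M (k + 1)).Dom), Z.1 ⊆ X.1 → ∀ t : Site (F.P K) (k + 1), wt K k Z t ≤ wt K k X t :=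
    fun K k Z X h t => tailWeight_mono _ h hB₃.le hδ₀.le
  refine windowedDecay_localizedSum_of_activitySlots F m' M hM S _ _ _ W (fun _ _ => univ) (fun _ _ _ _ => mem_univ _)
    (fun K k Z => {φ : CPair (F.P K) ℂ | ∀ b : PBond (F.P K) 0, ‖φ.1 b‖ ≤ Real.exp (r / wt K k Z (blockIter (k + 1) b.src))})
    hA.le (by positivity) le_rfl (by linarith) hR hsmall1 hδ₀ hB₃.le hr ?_
    (fun K k => Fin (F.P K).d → Site (F.P K) (k + 1) → ℂ)
    (fun K k X => LinearMap.toContinuousLinearMap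
      { toFun := fun B : Fin (F.P K).d → Site (F.P K) (k + 1) → ℝ => fun l t => ((B l t : ℝ) : ℂ) * (wt K k X t : ℂ)
        map_add' := fun B B' => by funext l t; simp only [Pi.add_apply]; push_cast; ring
        map_smul' := fun c B => by funext l t; simp only [Pi.smul_apply, smul_eq_mul, RingHom.id_apply, Complex.real_smul]; push_cast; ring })
    (fun K k X z => ((fun b : PBond (F.P K) 0 => Complex.exp (Complex.I * z b.dir (blockIter (k + 1) b.src) / (wt K k X (blockIter (k + 1) b.src) : ℂ))),
      fun _ => (0 : ℂ)))
    (fun K k X => ball 0 r) (fun _ _ _ => isOpen_ball) (fun _ _ _ => Subset.rfl) ?_ ?_ ?_ wt (fun K k X t => (hw0 K k X t).le) ?_ ?_ μ ν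
  · intro K k
    exact bound238_u1Step ((S K) k) (wt K k) (hS K k) hA.le _
  · intro g _ K k X Z _
    exact differentiableOn_H_comp_Φ ((S K) k) (wt K k) (hS K k) (wt K k X) (histPrefix g k) Z _
  · intro K k X B
    rw [LinearMap.coe_toContinuousLinearMap']
    exact Φ_ι_eq (wt K k X) (fun t => hw0 K k X t) B
  · intro K k X z hz Z hZX
    exact Φ_mem_sp (wt K k) (fun Z t => hw0 K k Z t) (fun Z X h t => hwmono K k Z X h t) X hz Z hZX
  · intro K k X l t c
    rw [LinearMap.coe_toContinuousLinearMap']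
    exact norm_ι_single_le (wt K k X) (fun t => (hw0 K k X t).le) l t c
  · intro K k X t
    exact le_rfl

end Fire

/-! ## §5 Realisation of the model towers, the chart and reading certificates, and the packaged non-degenerate witness -/

section Realise

variable (F : T4Family) (M : ℕ) [NeZero M]

/-- **THE U(1) MODEL TOWERS EXIST** with exactly the prescribed activities (one term per polymer `Z ∈ 𝐃_{k+1}`, index type `𝐃_{k+1}`, `idx Z = {Z}`), on every torus `K` and
level `k`, for any amplitude∕rate∕ratio∕radius∕tail letters. [folklore] -/
theorem exists_u1Towers (A R ω r δ₀ B₃ : ℝ) :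
    ∃ S : (K : ℕ) → ClusterTower (F.P K) ℂ M, ∀ (K k : ℕ) (g : Fin (k + 1) → ℝ) (φ : CPair (F.P K) ℂ) (Z : (domSys (F.P K) M (k + 1)).Dom),
      ((S K) k).H g φ Z = ((A * Real.exp (-(R * (domSys (F.P K) M (k + 1)).dj Z)) : ℝ) : ℂ) *
        Complex.exp (Complex.I * ((∑ i : Fin (k + 1), g i * ω ^ (k + 1 - (i : ℕ)) : ℝ) : ℂ)) *
        (((Fintype.card (Fin (F.P K).d × Site (F.P K) (k + 1)) : ℂ))⁻¹ *
          ∑ lt : Fin (F.P K).d × Site (F.P K) (k + 1),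
            ((Real.exp (-(r / (B₃ * Real.exp (-δ₀ * distCT (domCount (F.P K) M (k + 1)) M
                (fun i => (ZMod.cast ((blockIter (k + 1) (embIter (k + 1) lt.2)) i) : ZMod (domCount (F.P K) M (k + 1) * M)))
                (nearT (M := M) (fun i => (ZMod.cast ((blockIter (k + 1) (embIter (k + 1) lt.2)) i) : ZMod (domCount (F.P K) M (k + 1) * M))) Z))))) : ℝ) : ℂ) *
            φ.1 ⟨embIter (k + 1) lt.2, lt.1⟩) :=
  ⟨fun K k => ⟨(domSys (F.P K) M (k + 1)).Dom, fun Z => {Z}, fun Z g φ =>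
      ((A * Real.exp (-(R * (domSys (F.P K) M (k + 1)).dj Z)) : ℝ) : ℂ) *
        Complex.exp (Complex.I * ((∑ i : Fin (k + 1), g i * ω ^ (k + 1 - (i : ℕ)) : ℝ) : ℂ)) *
        (((Fintype.card (Fin (F.P K).d × Site (F.P K) (k + 1)) : ℂ))⁻¹ *
          ∑ lt : Fin (F.P K).d × Site (F.P K) (k + 1),
            ((Real.exp (-(r / (B₃ * Real.exp (-δ₀ * distCT (domCount (F.P K) M (k + 1)) M
                (fun i => (ZMod.cast ((blockIter (k + 1) (embIter (k + 1) lt.2)) i) : ZMod (domCount (F.P K) M (k + 1) * M)))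
                (nearT (M := M) (fun i => (ZMod.cast ((blockIter (k + 1) (embIter (k + 1) lt.2)) i) : ZMod (domCount (F.P K) M (k + 1) * M))) Z))))) : ℝ) : ℂ) *
            φ.1 ⟨embIter (k + 1) lt.2, lt.1⟩)⟩,
    fun K k g φ Z => by simp only [ClusterStep.H, Finset.sum_singleton]⟩

/-- **THE NON-ZERO CHART**: `ρ = (x ↦ ix)`, `ρ 1 = i ≠ 0` — so `ρ ≠ 0` (contrast: the zero chart of (C) p607185 ∕ g2 p602050, where every `polWindow` vanishes identically). [folklore] -/
theorem chart_ne_zero : ((ContinuousLinearMap.id ℝ ℝ).smulRight Complex.I : ℝ →L[ℝ] ℂ) ≠ 0 := fun h =>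
  Complex.I_ne_zero (by simpa using congrArg (fun f : ℝ →L[ℝ] ℂ => f 1) h)

open Classical in
/-- ★★★ **PACKAGED: A NON-DEGENERATE MODEL ON WHICH BOTH (A) CAPSTONES FIRE AT A NON-ZERO CHART.**  For every family `F`, cube side `M = L^{m′}`, window `W`, and letters
`δ₀, B₃, r > 0`, `ω ≥ 0`, with (C)'s admissible numerals `A₀ = (2e^{5r₁+1}K₀(64,8)·9·64)⁻¹`, `r₁ = κ = 2κ₀(64,8)`, `R₀ = r₁ + 128 log 162 + 2` (`smokeNumerals`): THERE ARE towers
`S` on every torus whose activities (i) VANISH at the zero configuration and (ii) are NON-ZERO at the unit configuration (so the localized sum READS the configuration), and (iii) carry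
a genuine phase in EVERY young coupling (`H(Z; g|g_i:=s) = H(Z; g|g_i:=0)·e^{isω^{k+1−i}}`), such that at the NON-ZERO chart `x ↦ ix`, the pulled-back reading and the singleton
basis BOTH W1-19b letters of (A) hold: `WindowedNE9 F (localizedSum F S emb) ρ bV W δ₁ (C_9·Λ)` (`Λ (k+1) i = A₀ω^{k+1−i}`) and `WindowedDecay … μ ν δ₁` for all `μ ν`.
A6's next rung after the zero-chart smoke tests (referee ref-F READ-497 NOTE-1); MODEL witness, declared — NOT NODE 00's objects, nothing of the record claimed. -/
theorem exists_nondegenerate_model_capstones_fire_nonzeroChart (m' : ℕ) (hM : M = F.L ^ m') (W : Set (ℕ → ℝ)) {ω r δ₀ B₃ : ℝ}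
    (hω : 0 ≤ ω) (hr : 0 < r) (hδ₀ : 0 < δ₀) (hB₃ : 0 < B₃) :
    ∃ S : (K : ℕ) → ClusterTower (F.P K) ℂ M,
      (∀ (K k : ℕ) (g : Fin (k + 1) → ℝ) (Z : (domSys (F.P K) M (k + 1)).Dom), ((S K) k).H g (0 : CPair (F.P K) ℂ) Z = 0) ∧
      (∀ (K k : ℕ) (g : Fin (k + 1) → ℝ) (Z : (domSys (F.P K) M (k + 1)).Dom), 0 < ‖((S K) k).H g ((fun _ => (1 : ℂ)), fun _ => (0 : ℂ)) Z‖) ∧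
      (∀ (K k : ℕ) (g : Fin (k + 1) → ℝ) (φ : CPair (F.P K) ℂ) (Z : (domSys (F.P K) M (k + 1)).Dom) (i : Fin (k + 1)) (s : ℝ),
        ((S K) k).H (Function.update g i s) φ Z = ((S K) k).H (Function.update g i 0) φ Z * Complex.exp (Complex.I * ((s * ω ^ (k + 1 - (i : ℕ)) : ℝ) : ℂ))) ∧
      WindowedNE9 F (localizedSum F S (fun K k W => ((fun b : PBond (F.P K) 0 => W b.dir (blockIter (k + 1) b.src)), fun _ => (0 : ℂ))))
        ((ContinuousLinearMap.id ℝ ℝ).smulRight Complex.I) (Module.Basis.singleton Unit ℝ) W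
        (delta1 δ₀ (2 * kappa₀ (4 * 2 ^ 4) (2 * 4)) ((M : ℝ) * 4))
        (fun k i => (16 * (8 * (Real.exp 1 * 9 * 64 * K₀ 64 8 ^ 2)) * B₃ ^ 2 / r ^ 2) *
          Real.exp (delta1 δ₀ (2 * kappa₀ (4 * 2 ^ 4) (2 * 4)) ((M : ℝ) * 4) * ((M : ℝ) * 4) * 3) * K₀ (4 * 2 ^ 4) (2 * 4) * K₁ 4 (δ₀ / 2) *
            ((1 / (2 * Real.exp (5 * (2 * kappa₀ (4 * 2 ^ 4) (2 * 4)) + 1) * K₀ 64 8 * 9 * 64)) * ω ^ (k - i))) ∧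
      ∀ μ ν : Fin 4, WindowedDecay F (localizedSum F S (fun K k W => ((fun b : PBond (F.P K) 0 => W b.dir (blockIter (k + 1) b.src)), fun _ => (0 : ℂ))))
        ((ContinuousLinearMap.id ℝ ℝ).smulRight Complex.I) (Module.Basis.singleton Unit ℝ) W μ ν
        (delta1 δ₀ (2 * kappa₀ (4 * 2 ^ 4) (2 * 4)) ((M : ℝ) * 4)) := by
  obtain ⟨hA, -, -, hsmall⟩ := smokeNumerals
  obtain ⟨S, hS⟩ := exists_u1Towers F M (1 / (2 * Real.exp (5 * (2 * kappa₀ (4 * 2 ^ 4) (2 * 4)) + 1) * K₀ 64 8 * 9 * 64))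
    (2 * kappa₀ (4 * 2 ^ 4) (2 * 4) + 2 * (64 * Real.log 162) + 2) ω r δ₀ B₃
  let wt : (K k : ℕ) → (domSys (F.P K) M (k + 1)).Dom → Site (F.P K) (k + 1) → ℝ := fun K k X t =>
    B₃ * Real.exp (-δ₀ * distCT (domCount (F.P K) M (k + 1)) M (fun i => (ZMod.cast (t i) : ZMod (domCount (F.P K) M (k + 1) * M)))
      (nearT (M := M) (fun i => (ZMod.cast (t i) : ZMod (domCount (F.P K) M (k + 1) * M))) X))
  refine ⟨S, fun K k g Z => H_zero_config ((S K) k) (wt K k) (hS K k) g Z, fun K k g Z => ?_,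
    fun K k g φ Z i s => H_update ((S K) k) (wt K k) (hS K k) g φ Z i s,
    windowedNE9_localizedSum_of_activitySlots_fires_nonzeroChart F M S hS m' hM W hA hsmall le_rfl hω hr hδ₀ hB₃,
    fun μ ν => windowedDecay_localizedSum_of_activitySlots_fires_nonzeroChart F M S hS m' hM W hA hsmall le_rfl hr hδ₀ hB₃ μ ν⟩
  haveI : Nonempty (Fin (F.P K).d × Site (F.P K) (k + 1)) := ⟨(⟨0, by simp⟩, fun _ => 0)⟩
  exact norm_H_one_config_pos ((S K) k) (wt K k) (hS K k) hA g Z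

end Realise

end YMDAG.N22.WindowSoftTwoPoint.NonzeroChart

end
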